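/-
Copyright (c) 2026. All rights reserved.
Released under Apache 2.0 license as described in the file LICENSE.
Authors: abc-iut cell, prover seat abc-iut-w6-d033 (wave 6, gen 0).
-/
import Literature.AnabelianGeometry.AbsoluteAnabelian.GlobalKummerMaps
import Literature.AnabelianGeometry.EtaleTheta.KummerMapExactness
import Literature.AnabelianGeometry.AbsoluteAnabelian.AbsTopIII.KummerFaithful
import HarnessLib

/-!
# [AbsTopIII] Cor 5.2 (iii), the `↪`: injectivity of the global Kummer map from Def 1.5 (a) level-wise

PROOF-ONLY companion (no definitions, no instances) of `GlobalKummerMaps.lean` (seat abc-iut-L4-t3, p428016),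
which CONSTRUCTS the Kummer map of [AbsTopIII] Cor 5.2 (iii) (kurims manuscript p. 119, bib key
`MochizukiAbsTopIII2015`),

> "(iii) In the notation of (ii), there exists a functorial [i.e., relative to `Th⊚_T`] algorithm for constructing
> the Kummer map `M⊚_TM ⥲ (M⊚_TM)^gp ⥲ M⊚_TLG ↪ lim_{→J} H¹(J, μ_Ẑ(M⊚_TM)) ⥲ lim_{→J} H¹(J, μ_Ẑ(Π))` — where “`J`”
> ranges over the open subgroups of `Π`",

as `TPairVocabulary.GlobCarrier.globalKummerMap C P : |M⊚| → lim_{→J} H¹(J, Λ(|M⊚|))` and records the printed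
"`↪`" as the named proposition `Cor52iiiKummerInjective` (an assumption on the carrier data `(W, C)`).

HERE that proposition is REDUCED to condition (a) of [AbsTopIII] Definition 1.5 (p. 32: "`⋂_{N ≥ 1} N · A(k_H) = {0}`"),
imposed LEVEL-WISE on the invariants `|M⊚|^J` of the open subgroups `J ⊆ Π` — i.e. to the tree's
`AbsTopIII.DivisibleElementsTrivial ↥(|M⊚|^J)`:

* `globalKummerMap_injective_of` — if for every open `J ⊆ Π` an element of `|M⊚|^J` admitting `n`-th roots in
  `|M⊚|^J` for every `n ≥ 1` is trivial, then the global Kummer map of `P` is injective (abc-iut-L2-t3's kernel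
  computation `EtaleTheta.kummerMapHom_injective_of`: a class vanishing in the direct limit vanishes at a finite
  level, where the Kummer cocycle is a coboundary iff the element has a compatible system of INVARIANT roots);
* `globalKummerMap_injective_of_divisibleElementsTrivial` — the same with the hypothesis packaged as
  `AbsTopIII.DivisibleElementsTrivial ↥(invariants J)` for every open `J`;
* `cor52iiiKummerInjective_of_divisibleElementsTrivial` — hence **`Cor52iiiKummerInjective W hT C`** under that
  level-wise hypothesis for every global `T`-pair `P`.

WHY THIS IS THE RIGHT RESIDUAL. For the genuine global arithmetic data `|M⊚| = k̄^×_NF(Π) ≅ k̄_NF^×` (Def 5.1 (ii),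
(v)), the invariants of an open `J ⊆ Π` are `(k̄_NF^×)^J = F_J^×` for the FINITE extension `F_J := k̄_NF^J` of the
number field (open = finite index), and "no non-trivial element of `F_J^×` is an `N`-th power in `F_J^×` for every
`N`" is exactly the `units` clause of `AbsTopIII.IsTorallyKummerFaithful` for number fields — [AbsTopIII]
Rmk 1.5.3 (i), the frozen fact F-0367 `AbsTopIII.Rmk_1_5_3_i`, PROVED in the tree (`rmk_1_5_3_i_holds`). So at
genuine data the printed "`↪`" costs nothing beyond a proved fact; what is NOT supplied here is the genuine
`GlobCarrier` itself (the étale-`π₁` / number-field carrier is interface data in `TPairs.lean` — TODO-merge), so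
the reduction is stated for an arbitrary carrier `C`. The converse (injective ⟹ level-wise (a)) would need
finiteness of the torsion of `|M⊚|^J` to assemble rational roots into a compatible system and is not asserted
([AbsTopIII] Def 1.5 calls (a) and (b) equivalent; only (a) ⟹ (b) is used and proved).

Refereed pre-IUT material ([AbsTopIII] §5, §1); nothing here bears on [IUTchIII] Cor. 3.12; typed ≠ proved;
no side is taken on the disputed corpus. [cite: MochizukiAbsTopIII2015, Cor 5.2 (iii) p.119]
-/

noncomputable section

open CategoryTheory

namespace Literature.AnabelianGeometry.AbsoluteAnabelian

open Literature.AnabelianGeometry.EtaleTheta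

namespace TPairVocabulary.GlobCarrier

variable {R : GlobalAnabelianContext.{0}} {T : TKind} {W : TPairVocabulary R T} (C : W.GlobCarrier)
  (P : GlobalTPair W)

/-- Membership in the invariants `|M⊚|^J` of the level `J` of the open-subgroup system, unfolded: `a` is fixed
by every `u ∈ J` under `u ↦ |P.act u|`. [cite: MochizukiAbsTopIII2015, Def 5.1 (v) p.117] -/
theorem mem_invariants_openSystem_iff (i : OpenIdx P) (a : C.carrier P.M) :
    (letI := C.action P; a ∈ invariants (A := C.carrier P.M) (openSystem P i)) ↔
      ∀ u : P.theater.grp, u ∈ (OrderDual.ofDual i : OpenSubgroup P.theater.grp) →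
        C.map (P.act u).hom a = a := by
  letI := C.action P
  constructor
  · intro h u hu
    have := h ⟨u, hu⟩
    change u • a = a at this
    rwa [C.action_smul] at this
  · intro h γ
    change ((γ : P.theater.grp) • a) = a
    rw [C.action_smul]
    exact h γ γ.2

open scoped Classical in
/-- **Cor 5.2 (iii), the `↪`, from Def 1.5 (a) level-wise**: if for every open subgroup `J ⊆ Π` an element of
`|M⊚|` fixed by `J` and admitting, for every `n ≥ 1`, an `n`-th root fixed by `J` is trivial
("`⋂_N (|M⊚|^J)^N = 1`"), then the global Kummer map `|M⊚| → lim_{→J} H¹(J, Λ(|M⊚|))` of the global `T`-pair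
`P` is injective. [cite: MochizukiAbsTopIII2015, Cor 5.2 (iii) p.119] -/
theorem globalKummerMap_injective_of
    (h : ∀ (J : OpenSubgroup P.theater.grp) (a : C.carrier P.M),
      (∀ u : P.theater.grp, u ∈ J → C.map (P.act u).hom a = a) →
      (∀ n : ℕ, 0 < n → ∃ b : C.carrier P.M,
        (∀ u : P.theater.grp, u ∈ J → C.map (P.act u).hom b = b) ∧ b ^ n = a) →
      a = 1) :
    Function.Injective (C.globalKummerMap P) := by
  letI := C.action P
  letI := C.rootable P
  have hker : ∀ (i : OpenIdx P) (a : C.carrier P.M), a ∈ invariants (A := C.carrier P.M) (openSystem P i) →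
      (∀ n : ℕ+, ∃ b ∈ invariants (A := C.carrier P.M) (openSystem P i), b ^ (n : ℕ) = a) → a = 1 := by
    intro i a ha hroots
    refine h (OrderDual.ofDual i) a ((C.mem_invariants_openSystem_iff P i a).1 ha) fun n hn => ?_
    obtain ⟨b, hb, hbn⟩ := hroots ⟨n, hn⟩
    exact ⟨b, (C.mem_invariants_openSystem_iff P i b).1 hb, hbn⟩
  have hinj := kummerMapHom_injective_of (openSystem P) (openSystem_anti P) (C.isExhausted P) hker
  intro a b hab
  have hab' : kummerMapHom (openSystem_anti P) (C.isExhausted P) (Additive.ofMul a) =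
      kummerMapHom (openSystem_anti P) (C.isExhausted P) (Additive.ofMul b) := hab
  exact Additive.ofMul.injective (hinj hab')

open scoped Classical in
/-- **Cor 5.2 (iii), the `↪`, from `DivisibleElementsTrivial` level-wise**: if for every open `J ⊆ Π` the group of
invariants `|M⊚|^J` satisfies condition (a) of [AbsTopIII] Def 1.5 (`AbsTopIII.DivisibleElementsTrivial`: an element
with `n`-th roots for all `n ≥ 1` is trivial), then the global Kummer map of `P` is injective.
[cite: MochizukiAbsTopIII2015, Cor 5.2 (iii) p.119] -/
theorem globalKummerMap_injective_of_divisibleElementsTrivial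
    (h : letI := C.action P;
      ∀ i : OpenIdx P, AbsTopIII.DivisibleElementsTrivial ↥(invariants (A := C.carrier P.M) (openSystem P i))) :
    Function.Injective (C.globalKummerMap P) := by
  letI := C.action P
  refine C.globalKummerMap_injective_of P fun J a ha hroots => ?_
  have ha' : a ∈ invariants (A := C.carrier P.M) (openSystem P (OrderDual.toDual J)) :=
    (C.mem_invariants_openSystem_iff P (OrderDual.toDual J) a).2 ha
  have key := (h (OrderDual.toDual J)).eq_one_of_forall_exists_pow ⟨a, ha'⟩ fun n hn => by
    obtain ⟨b, hb, hbn⟩ := hroots n hn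
    exact ⟨⟨b, (C.mem_invariants_openSystem_iff P (OrderDual.toDual J) b).2 hb⟩, Subtype.ext hbn⟩
  exact congrArg Subtype.val key

end TPairVocabulary.GlobCarrier

open scoped Classical in
/-- **[AbsTopIII] Cor 5.2 (iii), the printed "`↪`" (`Cor52iiiKummerInjective`), REDUCED to [AbsTopIII] Def 1.5 (a)
level-wise**: for `T ∈ {TF, TM}` and carrier data `C`, if for every global `T`-pair `P` and every open subgroup
`J ⊆ Π` the invariants `|M⊚|^J` have no non-trivial infinitely divisible element (`AbsTopIII.DivisibleElementsTrivial`;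
at genuine data `|M⊚|^J = F_J^×` for the number field `F_J = k̄_NF^J`, where this is F-0367 `AbsTopIII.Rmk_1_5_3_i`,
proved), then the Kummer map `M⊚_TLG → lim_{→J} H¹(J, μ_Ẑ(M⊚_TM))` is injective for every `P`.
[cite: MochizukiAbsTopIII2015, Cor 5.2 (iii) p.119] -/
theorem cor52iiiKummerInjective_of_divisibleElementsTrivial {R : GlobalAnabelianContext.{0}} {T : TKind}
    (W : TPairVocabulary R T) (hT : T ≠ .TLG) (C : W.GlobCarrier)
    (h : ∀ P : GlobalTPair W, letI := C.action P;
      ∀ i : TPairVocabulary.GlobCarrier.OpenIdx P,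
        AbsTopIII.DivisibleElementsTrivial
          ↥(invariants (A := C.carrier P.M) (TPairVocabulary.GlobCarrier.openSystem P i))) :
    Cor52iiiKummerInjective W hT C :=
  fun P => C.globalKummerMap_injective_of_divisibleElementsTrivial P (h P)

end Literature.AnabelianGeometry.AbsoluteAnabelian

end
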